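import Literature.AnabelianGeometry.EtaleTheta.ContH1InfRes
import Literature.AnabelianGeometry.EtaleTheta.Discharge.Sec1CompatHolds
import Literature.AnabelianGeometry.EtaleTheta.Discharge.Sec2ThetaOrbitClasses
import HarnessLib

/-!
# [EtTh] Prop. 1.5 (i), (ii): `F² = H¹(G_K, Δ_Θ)` and `F̈² = H¹(G_K̈, Δ_Θ)` as THEOREMS of the §1 model

Mochizuki, *The étale theta function …*, Publ. RIMS **45** (2009), Prop. 1.5, PRIMS PDF p. 23
(printed 249): "the natural filtration `0 ⊆ F² ⊆ F¹ ⊆ F⁰ = H¹((Π^tp_Y)^Θ, Δ_Θ)` … `F² = H¹(G_K, Δ_Θ)`"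
and, on `Ÿ`, "`F̈² = H¹(G_K̈, Δ_Θ)`" [cite: MochizukiEtTh2009, Prop 1.5 p.23]. Cell abc-iut, layer L2;
seat abc-iut-L2-t12 (unit W2-L2-08 (d), bridge lemmas). abc-iut-L2-t1 typed `F²`, `F̈²` as the
kernels of restriction to `(Δ^tp_Y)^Θ`, `(Δ^tp_Ÿ)^Θ` (`ThetaCohomology.F2`, `.Fdd2`) and carried the
printed identification with the cohomology of the QUOTIENT `(Π^tp_Y)^Θ/(Δ^tp_Y)^Θ = G_K` only in the
docstring (the carrier `ContH1` has no coefficients "of a quotient group"). With the degree-one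
inflation–restriction sequence for `ContH1` (`ContH1InfRes.lean`, over Mathlib's `continuousCohomology`
through `ContH1ContinuousCohomology.lean`) that identification is now PROVED in the §1 model:

* `DtpYTheta_normal`, `conjNormal_eq_of_mem_map_deltaTemp` — `(Δ^tp_Y)^Θ ⊴ (Π^tp_X)^Θ` (from
  abc-iut-L2-t1's `dtpY_normal`; the `Ÿ`-analogue is t1's `Compat.DtpYddTheta_normal`), and the
  whole geometric part `(Δ^tp_X)^Θ` acts trivially on `Δ_Θ` (root axiom `ker_thetaToEll_central`:
  "`Δ^Θ_X` is a central extension", p. 12);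
* `H1QuotY D` — `H¹((Π^tp_Y)^Θ/(Δ^tp_Y)^Θ, Δ_Θ)` (Mathlib's continuous `H¹` of the quotient acting on
  `Δ_Θ` by conjugation), `inflY D` — inflation into `F⁰ = H¹((Π^tp_Y)^Θ, Δ_Θ)`, injective;
* **`F2_eq_range_inflY`**: `F² = Im(inflation)`, and **`F2Equiv`**:
  `F² ≃* H¹((Π^tp_Y)^Θ/(Δ^tp_Y)^Θ, Δ_Θ)`;
* the same on `Ÿ` under the §1 compatibilities `Compat` (normality of `Π^tp_Ÿ`): `H1QuotYdd`,
  `inflYdd`, **`Fdd2_eq_range_inflYdd`**, **`Fdd2Equiv`**;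
* `quotYThetaEquivGK` — the quotient `(Π^tp_Y)^Θ/(Δ^tp_Y)^Θ` IS `G_K` (group isomorphism induced by
  the augmentation; `Ker(Π^tp_X ↠ (Π^tp_X)^Θ) ⊆ Δ^tp_X` and `Δ^tp_X ↠ Z`), so that the statements above
  are print's "`F² = H¹(G_K, Δ_Θ)`" up to this canonical identification of the acting group.

What this does NOT give: the further printed isomorphism `H¹(G_K, Δ_Θ) ≅ H¹(G_K, Ẑ(1)) ≅ (K^×)^∧`
(Tate twist `Δ_Θ ≅ Ẑ(1)` — a deferred transcription of `Setting.lean` — and local Kummer theory in the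
limit), i.e. the clause `Prop15i.F2_eq : F² = Im(kumY)` remains a statement about the `KummerData`.
Proof-only over landed definitions; nothing of [EtTh] beyond the §1 root axioms is assumed; no side is
taken on any disputed claim.
-/

noncomputable section

namespace Literature.AnabelianGeometry.EtaleTheta

open Literature.AnabelianGeometry.SemiGraphs

namespace ThetaSetting

variable {p : ℕ} [Fact p.Prime] (D : ThetaSetting p)

/-! ### `(Δ^tp_X)^Θ` acts trivially on `Δ_Θ`; normality of the geometric parts -/

/-- `(Δ^tp_Y)^Θ` is normal in `(Π^tp_X)^Θ` (image of a normal subgroup under `Π^tp_X ↠ (Π^tp_X)^Θ`).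
[cite: MochizukiEtTh2009, §1 p.12] -/
theorem DtpYTheta_normal : (D.DtpY.map D.toTheta).Normal :=
  haveI := D.dtpY_normal
  Subgroup.Normal.map inferInstance D.toTheta D.toTheta_surjective

/-- **The geometric part acts trivially on the cyclotome**: conjugation by any element of
`(Δ^tp_X)^Θ = θ(Δ^tp_X)` fixes `Δ_Θ` pointwise ("`Δ^Θ_X` … central extension", root axiom
`ker_thetaToEll_central`, p. 12). [cite: MochizukiEtTh2009, §1 p.12] -/
theorem conjNormal_eq_of_mem_map_deltaTemp {n : D.GtpTheta}
    (hn : n ∈ D.DeltaTemp.map D.toTheta) (a : D.DeltaTheta) :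
    MulAut.conjNormal (MonoidHom.id D.GtpTheta n) a = a := by
  apply Subtype.ext
  rw [MulAut.conjNormal_apply, MonoidHom.id_apply]
  have h := D.ker_thetaToEll_central (a : D.GtpTheta) a.2 n hn
  rw [← h, mul_inv_cancel_right]

/-- `(Δ^tp_Y)^Θ` acts trivially on `Δ_Θ`. [cite: MochizukiEtTh2009, §1 p.12] -/
theorem conjNormal_eq_of_mem_DtpYTheta :
    ∀ n ∈ D.DtpY.map D.toTheta, ∀ a : D.DeltaTheta,
      MulAut.conjNormal (MonoidHom.id D.GtpTheta n) a = a :=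
  fun _ hn a => D.conjNormal_eq_of_mem_map_deltaTemp (Subgroup.map_mono inf_le_right hn) a

/-- `(Δ^tp_Ÿ)^Θ` acts trivially on `Δ_Θ`. [cite: MochizukiEtTh2009, §1 p.12] -/
theorem conjNormal_eq_of_mem_DtpYddTheta :
    ∀ n ∈ (D.DtpYddN 1).map D.toTheta, ∀ a : D.DeltaTheta,
      MulAut.conjNormal (MonoidHom.id D.GtpTheta n) a = a :=
  fun _ hn a => D.conjNormal_eq_of_mem_map_deltaTemp (Subgroup.map_mono inf_le_right hn) a

/-- Normality of `(Δ^tp_Y)^Θ` inside `(Π^tp_Y)^Θ` (for the quotient `(Π^tp_Y)^Θ/(Δ^tp_Y)^Θ`).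
[cite: MochizukiEtTh2009, §1 p.12] -/
instance normal_DtpYTheta_subgroupOf :
    ((D.DtpY.map D.toTheta).subgroupOf (D.GtpY.map D.toTheta)).Normal :=
  haveI := D.DtpYTheta_normal
  inferInstance

/-! ### `F² = H¹((Π^tp_Y)^Θ/(Δ^tp_Y)^Θ, Δ_Θ)` -/

/-- **`H¹((Π^tp_Y)^Θ/(Δ^tp_Y)^Θ, Δ_Θ)`** — print's "`H¹(G_K, Δ_Θ)`" (p. 23): Mathlib's continuous `H¹` of
the quotient group acting on `Δ_Θ` by conjugation. [cite: MochizukiEtTh2009, Prop 1.5 (i) p.23] -/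
abbrev H1QuotY : Type :=
  continuousCohomology 1 (quotConjTopRep (MonoidHom.id D.GtpTheta) D.DeltaTheta
    (D.GtpY.map D.toTheta) D.conjNormal_eq_of_mem_DtpYTheta)

/-- **Inflation** `H¹((Π^tp_Y)^Θ/(Δ^tp_Y)^Θ, Δ_Θ) → F⁰ = H¹((Π^tp_Y)^Θ, Δ_Θ)`.
[cite: MochizukiEtTh2009, Prop 1.5 (i) p.23] -/
def inflY : Multiplicative D.H1QuotY →* D.H1Theta (D.GtpY.map D.toTheta) :=
  ContH1.inflOfQuotient (MonoidHom.id D.GtpTheta) D.DeltaTheta (D.GtpY.map D.toTheta)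
    D.conjNormal_eq_of_mem_DtpYTheta

/-- Inflation into `F⁰` is injective. [cite: MochizukiEtTh2009, Prop 1.5 (i) p.23] -/
theorem inflY_injective : Function.Injective D.inflY :=
  ContH1.inflOfQuotient_injective _ _ _ _

/-- **`F² = H¹(G_K, Δ_Θ)`, PROVED in the form `F² = Im(inflation from (Π^tp_Y)^Θ/(Δ^tp_Y)^Θ)`**:
the kernel of restriction to `(Δ^tp_Y)^Θ` (abc-iut-L2-t1's `F2`) is exactly the range of inflation
(degree-one inflation–restriction; `(Δ^tp_Y)^Θ` acts trivially on `Δ_Θ`).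
[cite: MochizukiEtTh2009, Prop 1.5 (i) p.23] -/
theorem F2_eq_range_inflY : (F2 : Subgroup (D.H1Theta (D.GtpY.map D.toTheta))) = D.inflY.range :=
  (ContH1.range_inflOfQuotient_eq_ker_res (MonoidHom.id D.GtpTheta) D.DeltaTheta (D.GtpY.map D.toTheta)
    (Subgroup.map_mono inf_le_left : D.DtpY.map D.toTheta ≤ D.GtpY.map D.toTheta)
    D.conjNormal_eq_of_mem_DtpYTheta continuous_id).symm

/-- **`F² ≅ H¹((Π^tp_Y)^Θ/(Δ^tp_Y)^Θ, Δ_Θ)`** (`= H¹(G_K, Δ_Θ)`, p. 23), the isomorphism being inflation.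
[cite: MochizukiEtTh2009, Prop 1.5 (i) p.23] -/
def F2Equiv : Multiplicative D.H1QuotY ≃* (F2 : Subgroup (D.H1Theta (D.GtpY.map D.toTheta))) :=
  (ContH1.kerResEquivQuotient (MonoidHom.id D.GtpTheta) D.DeltaTheta (D.GtpY.map D.toTheta)
    (Subgroup.map_mono inf_le_left : D.DtpY.map D.toTheta ≤ D.GtpY.map D.toTheta)
    D.conjNormal_eq_of_mem_DtpYTheta continuous_id).trans (MulEquiv.subgroupCongr rfl)

/-- `F2Equiv` is inflation. [cite: MochizukiEtTh2009, Prop 1.5 (i) p.23] -/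
@[simp] theorem coe_F2Equiv_apply (y : Multiplicative D.H1QuotY) :
    ((D.F2Equiv y : (F2 : Subgroup (D.H1Theta (D.GtpY.map D.toTheta)))) :
      D.H1Theta (D.GtpY.map D.toTheta)) = D.inflY y := rfl

/-! ### `F̈² = H¹((Π^tp_Ÿ)^Θ/(Δ^tp_Ÿ)^Θ, Δ_Θ)` (under `Compat`) -/

section Ydd

variable {D}

/-- Normality of `(Δ^tp_Ÿ)^Θ` inside `(Π^tp_Ÿ)^Θ`, under the §1 compatibilities.
[cite: MochizukiEtTh2009, Prop 1.5 (ii) p.23] -/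
theorem Compat.normal_DtpYddTheta_subgroupOf (hC : D.Compat) :
    (((D.DtpYddN 1).map D.toTheta).subgroupOf (D.GtpYdd.map D.toTheta)).Normal :=
  haveI := hC.DtpYddTheta_normal
  inferInstance

/-- **`H¹((Π^tp_Ÿ)^Θ/(Δ^tp_Ÿ)^Θ, Δ_Θ)`** — print's "`H¹(G_K̈, Δ_Θ)`" (p. 23).
[cite: MochizukiEtTh2009, Prop 1.5 (ii) p.23] -/
abbrev Compat.H1QuotYdd (hC : D.Compat) : Type :=
  haveI := hC.normal_DtpYddTheta_subgroupOf
  continuousCohomology 1 (quotConjTopRep (MonoidHom.id D.GtpTheta) D.DeltaTheta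
    (D.GtpYdd.map D.toTheta) D.conjNormal_eq_of_mem_DtpYddTheta)

/-- **Inflation** `H¹((Π^tp_Ÿ)^Θ/(Δ^tp_Ÿ)^Θ, Δ_Θ) → F̈⁰ = H¹((Π^tp_Ÿ)^Θ, Δ_Θ)`.
[cite: MochizukiEtTh2009, Prop 1.5 (ii) p.23] -/
def Compat.inflYdd (hC : D.Compat) :
    Multiplicative hC.H1QuotYdd →* D.H1Theta (D.GtpYdd.map D.toTheta) :=
  haveI := hC.normal_DtpYddTheta_subgroupOf
  ContH1.inflOfQuotient (MonoidHom.id D.GtpTheta) D.DeltaTheta (D.GtpYdd.map D.toTheta)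
    D.conjNormal_eq_of_mem_DtpYddTheta

/-- Inflation into `F̈⁰` is injective. [cite: MochizukiEtTh2009, Prop 1.5 (ii) p.23] -/
theorem Compat.inflYdd_injective (hC : D.Compat) : Function.Injective hC.inflYdd :=
  haveI := hC.normal_DtpYddTheta_subgroupOf
  ContH1.inflOfQuotient_injective _ _ _ _

/-- **`F̈² = H¹(G_K̈, Δ_Θ)`, PROVED in the form `F̈² = Im(inflation from (Π^tp_Ÿ)^Θ/(Δ^tp_Ÿ)^Θ)`**.
[cite: MochizukiEtTh2009, Prop 1.5 (ii) p.23] -/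
theorem Compat.Fdd2_eq_range_inflYdd (hC : D.Compat) :
    (Fdd2 : Subgroup (D.H1Theta (D.GtpYdd.map D.toTheta))) = hC.inflYdd.range :=
  haveI := hC.normal_DtpYddTheta_subgroupOf
  (ContH1.range_inflOfQuotient_eq_ker_res (MonoidHom.id D.GtpTheta) D.DeltaTheta
    (D.GtpYdd.map D.toTheta)
    (Subgroup.map_mono inf_le_left : (D.DtpYddN 1).map D.toTheta ≤ D.GtpYdd.map D.toTheta)
    D.conjNormal_eq_of_mem_DtpYddTheta continuous_id).symm

/-- **`F̈² ≅ H¹((Π^tp_Ÿ)^Θ/(Δ^tp_Ÿ)^Θ, Δ_Θ)`** (`= H¹(G_K̈, Δ_Θ)`, p. 23), by inflation.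
[cite: MochizukiEtTh2009, Prop 1.5 (ii) p.23] -/
def Compat.Fdd2Equiv (hC : D.Compat) :
    Multiplicative hC.H1QuotYdd ≃* (Fdd2 : Subgroup (D.H1Theta (D.GtpYdd.map D.toTheta))) :=
  haveI := hC.normal_DtpYddTheta_subgroupOf
  (ContH1.kerResEquivQuotient (MonoidHom.id D.GtpTheta) D.DeltaTheta (D.GtpYdd.map D.toTheta)
    (Subgroup.map_mono inf_le_left : (D.DtpYddN 1).map D.toTheta ≤ D.GtpYdd.map D.toTheta)
    D.conjNormal_eq_of_mem_DtpYddTheta continuous_id).trans (MulEquiv.subgroupCongr rfl)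

/-- `Fdd2Equiv` is inflation. [cite: MochizukiEtTh2009, Prop 1.5 (ii) p.23] -/
@[simp] theorem Compat.coe_Fdd2Equiv_apply (hC : D.Compat) (y : Multiplicative hC.H1QuotYdd) :
    ((hC.Fdd2Equiv y : (Fdd2 : Subgroup (D.H1Theta (D.GtpYdd.map D.toTheta)))) :
      D.H1Theta (D.GtpYdd.map D.toTheta)) = hC.inflYdd y := rfl

variable (D)

end Ydd

/-! ### The quotient `(Π^tp_Y)^Θ/(Δ^tp_Y)^Θ` is `G_K` -/

/-- The augmentation of `g ∈ Π^tp_X` only depends on `θ(g) ∈ (Π^tp_X)^Θ`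
(`Ker(Π^tp_X ↠ (Π^tp_X)^Θ) ⊆ Δ^tp_X = Ker(aug)`, `EtaleThetaClass.ker_toTheta_le_deltaTemp`).
[cite: MochizukiEtTh2009, §1 p.12] -/
theorem aug_eq_of_toTheta_eq {g g' : D.PiTemp} (h : D.toTheta g = D.toTheta g') :
    D.aug g = D.aug g' := by
  have hk : g⁻¹ * g' ∈ D.toTheta.ker := by
    rw [MonoidHom.mem_ker, map_mul, map_inv, h, inv_mul_cancel]
  have hΔ : D.aug.toMonoidHom (g⁻¹ * g') = 1 := D.ker_toTheta_le_deltaTemp hk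
  rw [map_mul, map_inv, inv_mul_eq_one] at hΔ
  exact hΔ

/-- `aug(g) ∈ G_K` for `g ∈ Π^tp_Y`. [cite: MochizukiEtTh2009, §1 p.13] -/
theorem aug_mem_GK_of_mem_GtpY {g : D.PiTemp} (hg : g ∈ D.GtpY) : D.aug g ∈ D.GK :=
  D.map_aug_GtpY.le ⟨g, hg, rfl⟩

/-- **The augmentation on `(Π^tp_Y)^Θ`**: `θ(g) ↦ aug(g) ∈ G_K` (well defined by
`aug_eq_of_toTheta_eq`). [cite: MochizukiEtTh2009, §1 p.12] -/
def augYTheta : ↥(D.GtpY.map D.toTheta) →* ↥D.GK where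
  toFun x := ⟨D.aug (Classical.choose (Subgroup.mem_map.1 x.2)),
    D.aug_mem_GK_of_mem_GtpY (Classical.choose_spec (Subgroup.mem_map.1 x.2)).1⟩
  map_one' := by
    apply Subtype.ext
    have hs := Classical.choose_spec (Subgroup.mem_map.1 (1 : ↥(D.GtpY.map D.toTheta)).2)
    change D.aug (Classical.choose (Subgroup.mem_map.1 (1 : ↥(D.GtpY.map D.toTheta)).2)) = 1
    rw [D.aug_eq_of_toTheta_eq (hs.2.trans (map_one D.toTheta).symm), map_one]
  map_mul' x y := by
    apply Subtype.ext
    have hx := Classical.choose_spec (Subgroup.mem_map.1 x.2)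
    have hy := Classical.choose_spec (Subgroup.mem_map.1 y.2)
    have hxy := Classical.choose_spec (Subgroup.mem_map.1 (x * y).2)
    change D.aug (Classical.choose (Subgroup.mem_map.1 (x * y).2)) =
      D.aug (Classical.choose (Subgroup.mem_map.1 x.2)) * D.aug (Classical.choose (Subgroup.mem_map.1 y.2))
    rw [← map_mul]
    apply D.aug_eq_of_toTheta_eq
    rw [hxy.2, map_mul, hx.2, hy.2]
    rfl

/-- `augYTheta (θ g) = aug g` for `g ∈ Π^tp_Y`. [cite: MochizukiEtTh2009, §1 p.12] -/
theorem augYTheta_apply {g : D.PiTemp} (hg : g ∈ D.GtpY) :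
    (D.augYTheta ⟨D.toTheta g, ⟨g, hg, rfl⟩⟩ : GQp p) = D.aug g := by
  have hs := Classical.choose_spec
    (Subgroup.mem_map.1 (⟨D.toTheta g, ⟨g, hg, rfl⟩⟩ : ↥(D.GtpY.map D.toTheta)).2)
  exact D.aug_eq_of_toTheta_eq hs.2

/-- `augYTheta` is onto `G_K`. [cite: MochizukiEtTh2009, §1 p.13] -/
theorem augYTheta_surjective : Function.Surjective D.augYTheta := by
  rintro ⟨σ, hσ⟩
  obtain ⟨g, hg, rfl⟩ := D.map_aug_GtpY.ge hσ
  exact ⟨⟨D.toTheta g, ⟨g, hg, rfl⟩⟩, Subtype.ext (D.augYTheta_apply hg)⟩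

/-- `Ker(augYTheta) = (Δ^tp_Y)^Θ`. [cite: MochizukiEtTh2009, §1 p.12] -/
theorem ker_augYTheta :
    D.augYTheta.ker = (D.DtpY.map D.toTheta).subgroupOf (D.GtpY.map D.toTheta) := by
  ext ⟨x, hx⟩
  obtain ⟨g, hg, rfl⟩ := hx
  rw [MonoidHom.mem_ker, Subgroup.mem_subgroupOf]
  constructor
  · intro h
    have h1 : D.aug g = 1 := by
      rw [← D.augYTheta_apply hg]
      exact congrArg Subtype.val h
    exact ⟨g, ⟨hg, h1⟩, rfl⟩
  · rintro ⟨d, hd, hdg⟩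
    apply Subtype.ext
    change (D.augYTheta ⟨D.toTheta g, ⟨g, hg, rfl⟩⟩ : GQp p) = 1
    rw [D.augYTheta_apply hg, ← D.aug_eq_of_toTheta_eq hdg]
    exact hd.2

/-- **`(Π^tp_Y)^Θ/(Δ^tp_Y)^Θ ≅ G_K`** (as groups, via the augmentation): the acting group of
`H1QuotY` is print's `G_K`. [cite: MochizukiEtTh2009, Prop 1.5 (i) p.23] -/
def quotYThetaEquivGK :
    ↥(D.GtpY.map D.toTheta) ⧸ (D.DtpY.map D.toTheta).subgroupOf (D.GtpY.map D.toTheta) ≃* ↥D.GK :=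
  (QuotientGroup.quotientMulEquivOfEq D.ker_augYTheta.symm).trans
    (QuotientGroup.quotientKerEquivOfSurjective D.augYTheta D.augYTheta_surjective)

end ThetaSetting

end Literature.AnabelianGeometry.EtaleTheta
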